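import Mathlib.Algebra.MonoidAlgebra.Basic
import Mathlib.Algebra.MonoidAlgebra.Module
import Mathlib.RingTheory.LaurentSeries
import Mathlib.LinearAlgebra.Finsupp.LinearCombination
import Mathlib.Analysis.Complex.Basic
import HarnessLib

/-!
# Ayoub's relative Kontsevich–Zagier theorem — the REVISITED, purely algebraic version

Topic `Literature/NumberTheory/Transcendental`; definition request `wi-03779`
(`AyoubRelativePeriods`, route AyoubSpecialisation; the `periods.S33` gap of `Sweep1.lean`).

**What the request asked for, and why we vend something else.** The request asks for the
statement of Ayoub, *Une version relative de la conjecture des périodes de Kontsevich–Zagier*,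
Ann. of Math. 181 (2015), Thm. 4.25 (= Thm. 1.1 of the sequel note): the kernel of term-by-term
integration `𝒪†_{k-alg}(𝔻̄^∞) → ℂ((ϖ))` on Laurent series of algebraic holomorphic germs on closed
polydiscs is spanned by the "obvious" relations. In the sequel note (J. Ayoub, *La version
relative de la conjecture des périodes de Kontsevich–Zagier revisitée*, §1.1, Remarque 1.3) the
AUTHOR STATES THAT THIS THEOREM, AS PRINTED, IS ONLY PROVED UNDER THE EXTRA HYPOTHESIS THAT
`π ∈ ℂ` IS ALGEBRAIC OVER `k` (an error in the proof of loc. cit. Thm. 3.27), and that it is NOT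
KNOWN for general `k` — in particular not for `k = ℚ̄`, the case the request wants. D-0014 forbids
vending it. The same note proves instead (Théorème 1.7) a corrected statement which is, in the
author's words, "purement algébrique et nettement plus satisfaisant", and repairs Thm. 4.25 as an
injectivity statement (Théorème 1.11). WE VEND THÉORÈME 1.7, verbatim, for fields `k` of
characteristic `0` embeddable in `ℂ`:

Let `z = (z₁, z₂, …)`, `t = (t₁, t₂, …)`, `𝒪 := 𝒪(𝔸^∞ × 𝔼^∞) = k[z, t, t⁻¹]` (polynomial in the
`zᵢ`, Laurent polynomial in the `tⱼ`, finitely many variables at a time), and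
`𝒪†_alg ⊂ 𝒪((ϖ)) = 𝒪[[ϖ]][ϖ⁻¹]` the `k`-subspace of Laurent series in `ϖ` ALGEBRAIC over
`Frac(𝒪)(ϖ)` (equivalently: annihilated by a non-zero polynomial with coefficients in `𝒪[ϖ]`).
Integration (Lemmes 1.4–1.5, "c'est évident"): the `k`-linear `∫ : 𝒪 → k`,
`∫ z^a t^b = [b = 0] · ∏ᵢ 1/(aᵢ + 1)` (i.e. `∫_{[0,1]^m} dz · (2πi)^{-n} ∮ dt/t`), extended term by
term to `∫ : 𝒪((ϖ)) → k((ϖ))`.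
**Théorème 1.7.** The kernel of `∫` on `𝒪†_alg` is the `k`-subspace spanned by
 (a) `∂G/∂zᵢ - G|_{zᵢ=1} + G|_{zᵢ=0}`, `G ∈ 𝒪†_alg`, `i ≥ 1`;
 (b) `tⱼ ∂H/∂tⱼ`, `H ∈ 𝒪†_alg`, `j ≥ 1`.

## Lean rendering (all honest definitions)

* monomials `Mono = (ℕ →₀ ℕ) × (ℕ →₀ ℤ)` (exponents of `z`, `t`), `𝒪 k = AddMonoidAlgebra k Mono`;
* `intO : 𝒪 k →ₗ[k] k` (`Finsupp.linearCombination` of the monomial weights), `dz i`, `restr i c`,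
  `euler j : 𝒪 k →ₗ[k] 𝒪 k` on monomials as printed; `relA i = dz i - restr i 1 + restr i 0`;
* `mapCoeff` — a `k`-linear map applied coefficientwise to `LaurentSeries` (Mathlib `HahnSeries ℤ`),
  giving `intLaurent` and the coefficientwise `relA i`, `euler j`;
* `IsAlgebraicLaurent F` (a non-zero `P ∈ 𝒪[ϖ][Y]` with `P(F) = 0` in `𝒪((ϖ))`, `ϖ ↦ single 1 1`),
  `Odagger k : Set (LaurentSeries (𝒪 k))`;
* `ayoubGenerators k`, and the NAMED FACT `ayoub_relativeKZ_revisited`. Nothing asserted.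
* PROVED (last section): the easy inclusion `span (a) ∪ (b) ⊆ ker ∫` of Théorème 1.7
  (`span_ayoubGenerators_le_ker`, `ayoub_relativeKZ_revisited_easy`), i.e. the `←` half of the
  named fact's `iff`, for every field of characteristic `0`. The `→` half is the whole content of
  the note's §2 (proof: Thm. 1.7 ⇐ Thms. 2.4 + 2.6; Thm. 2.4 = injectivity of
  `∫ : Q^ϖ(F,σ) ⊗_{𝒫(k,σ)} P(k,σ) → ℂ((ϖ))`, from Ann. of Math. 181 Cor. 4.24 and the motivic torsor
  `Spec P^ϖ(F,σ)`; Thm. 2.6 = `F†(k) ⊗_k P(k,σ) ≃ Q^ϖ(F,σ) ⊗ P(k,σ)`, computed in `DM(k)` via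
  Voevodsky motives over `k(ϖ)`, rigid-analytic motives and the Betti realisation) — a theory absent
  from Lean; it stays a named fact.

## References

* J. Ayoub, *Une version relative de la conjecture des périodes de Kontsevich–Zagier*, Ann. of
  Math. (2) 181 (2015) 905–992, Thm. 4.25 (see the caveat above).
* J. Ayoub, *La version relative de la conjecture des périodes de Kontsevich–Zagier revisitée*,
  note (Univ. Zürich, `rel-KZ-bis.pdf`) = Tohoku Math. J. (2) 71 (2019), no. 3, 465–485
  (doi:10.2748/tmj/1568772181), §1: Lemmes 1.4–1.5, Notation 1.6, Théorème 1.7, Remarque 1.3,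
  Thm. 1.11; §2 (proof: Thms. 2.3, 2.4, 2.6, 2.8, 2.14, Cor. 2.16, Prop. 2.18).
* J. Ayoub, *Periods and the conjectures of Grothendieck and Kontsevich–Zagier*, EMS Newsletter 91
  (2014) (`Ayoub2014`); A. Huber, S. Müller-Stach, *Periods and Nori Motives* (2017), Ch. 13.
-/

noncomputable section

open Finsupp Polynomial

namespace Literature.NumberTheory.Transcendental.AyoubRel

/-- Exponent vectors of the monomials `z^a t^b` (`a` finitely supported in `ℕ`, `b` in `ℤ`).
[Ayoub, revisited note, §1.2 (`𝒪(𝔸^∞ × 𝔼^∞) = k[z, t, t⁻¹]`)] [folklore] -/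
abbrev Mono : Type := (ℕ →₀ ℕ) × (ℕ →₀ ℤ)

/-- `𝒪 = k[z₁, z₂, …, t₁^{±1}, t₂^{±1}, …]` as the monoid algebra of `Mono`.
[Ayoub, revisited note, §1.2] [cite: AyoubRelKZRevisited, §1.2] -/
abbrev O (k : Type) [Field k] : Type := AddMonoidAlgebra k Mono

variable (k : Type) [Field k]

/-! ### Integration and the operators on `𝒪` -/

/-- The weight of a monomial under `∫`: `∫ z^a t^b = [b = 0] · ∏ᵢ (aᵢ + 1)⁻¹`
(`∫_{[0,1]} zᵢ^{aᵢ} dzᵢ = 1/(aᵢ+1)`, `(2πi)⁻¹ ∮ t^{bⱼ} dt/t = [bⱼ = 0]`).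
[Ayoub, revisited note, Lemmes 1.4–1.5] [cite: AyoubRelKZRevisited, Lemme 1.5] -/
def monoWeight (m : Mono) : k :=
  if m.2 = 0 then ∏ i ∈ m.1.support, ((m.1 i : k) + 1)⁻¹ else 0

/-- **The integration morphism** `∫ : 𝒪 → k` (Lemme 1.5), `k`-linear.
[Ayoub, revisited note, Lemme 1.5] [cite: AyoubRelKZRevisited, Lemme 1.5] -/
def intO : O k →ₗ[k] k :=
  Finsupp.linearCombination k (monoWeight k) ∘ₗ (AddMonoidAlgebra.coeffLinearEquiv k).toLinearMap

/-- The monomial `z^a t^b` as an element of `𝒪`. [folklore] -/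
def mono (m : Mono) : O k := AddMonoidAlgebra.single m 1

/-- `∂/∂zᵢ` on `𝒪`: `z^a t^b ↦ aᵢ · z^{a - eᵢ} t^b`. [Ayoub, revisited note, Thm. 1.7 (a)] [cite: AyoubRelKZRevisited, Théorème 1.7] -/
def dz (i : ℕ) : O k →ₗ[k] O k :=
  (Finsupp.linearCombination k fun m : Mono => (m.1 i : k) • mono k (m.1 - Finsupp.single i 1, m.2)) ∘ₗ
    (AddMonoidAlgebra.coeffLinearEquiv k).toLinearMap

/-- Restriction `zᵢ = c` on `𝒪`: `z^a t^b ↦ c^{aᵢ} · z^{a|_{aᵢ := 0}} t^b`.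
[Ayoub, revisited note, Thm. 1.7 (a) (`G|_{zᵢ=1}`, `G|_{zᵢ=0}`)] [cite: AyoubRelKZRevisited, Théorème 1.7] -/
def restr (i : ℕ) (c : k) : O k →ₗ[k] O k :=
  (Finsupp.linearCombination k fun m : Mono => c ^ (m.1 i) • mono k (m.1.erase i, m.2)) ∘ₗ
    (AddMonoidAlgebra.coeffLinearEquiv k).toLinearMap

/-- The Euler operator `tⱼ ∂/∂tⱼ` on `𝒪`: `z^a t^b ↦ bⱼ · z^a t^b`.
[Ayoub, revisited note, Thm. 1.7 (b)] [cite: AyoubRelKZRevisited, Théorème 1.7] -/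
def euler (j : ℕ) : O k →ₗ[k] O k :=
  (Finsupp.linearCombination k fun m : Mono => (m.2 j : k) • mono k m) ∘ₗ
    (AddMonoidAlgebra.coeffLinearEquiv k).toLinearMap

/-- The relation operator of type (a): `G ↦ ∂G/∂zᵢ - G|_{zᵢ=1} + G|_{zᵢ=0}`.
[Ayoub, revisited note, Thm. 1.7 (a)] [cite: AyoubRelKZRevisited, Théorème 1.7] -/
def relA (i : ℕ) : O k →ₗ[k] O k :=
  dz k i - restr k i 1 + restr k i 0

/-! ### Laurent series in `ϖ` -/

/-- Apply a `k`-linear map coefficientwise to a Laurent series (support can only shrink).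
[Ayoub, revisited note, §1.2 ("en intégrant … terme à terme")] [folklore] -/
def mapCoeff {V W : Type} [AddCommGroup V] [Module k V] [AddCommGroup W] [Module k W]
    (f : V →ₗ[k] W) : LaurentSeries V →ₗ[k] LaurentSeries W where
  toFun F :=
    { coeff := fun n => f (F.coeff n)
      isPWO_support' := F.isPWO_support'.mono (by
        intro n hn
        simp only [Function.mem_support, ne_eq] at hn ⊢
        intro h; exact hn (by rw [h, map_zero])) }
  map_add' F G := by ext n; simp
  map_smul' c F := by ext n; simp

/-- **Term-by-term integration** `∫ : 𝒪((ϖ)) → k((ϖ))`, the morphism (5) of the note.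
[Ayoub, revisited note, Théorème 1.7 (the map (5))] [cite: AyoubRelKZRevisited, Théorème 1.7] -/
def intLaurent : LaurentSeries (O k) →ₗ[k] LaurentSeries k :=
  mapCoeff k (intO k)

/-- `𝒪[ϖ] → 𝒪((ϖ))`, `ϖ ↦ ϖ`. [folklore] -/
def polyToLaurent : Polynomial (O k) →ₐ[O k] LaurentSeries (O k) :=
  Polynomial.aeval (HahnSeries.single 1 1)

/-- `F ∈ 𝒪((ϖ))` is ALGEBRAIC over `Frac(𝒪)(ϖ)`, equivalently annihilated by a non-zero
`P(ϖ, Y) ∈ 𝒪[ϖ][Y]`. [Ayoub, revisited note, Notation 1.6] [cite: AyoubRelKZRevisited, Notation 1.6] -/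
def IsAlgebraicLaurent (F : LaurentSeries (O k)) : Prop :=
  ∃ P : Polynomial (Polynomial (O k)), P ≠ 0 ∧
    Polynomial.eval₂ (polyToLaurent k).toRingHom F P = 0

/-- `𝒪†_alg(𝔸^∞ × 𝔼^∞)`: the algebraic Laurent series. [Ayoub, revisited note, Notation 1.6] [cite: AyoubRelKZRevisited, Notation 1.6] -/
def Odagger : Set (LaurentSeries (O k)) :=
  {F | IsAlgebraicLaurent k F}

/-- The generators of Théorème 1.7: (a) `∂G/∂zᵢ - G|_{zᵢ=1} + G|_{zᵢ=0}` and (b) `tⱼ ∂H/∂tⱼ`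
(coefficientwise in `ϖ`) for `G, H ∈ 𝒪†_alg` and `i, j` ranging over the variables (the note's
`i, j ∈ ℕ ∖ {0}` index `z₁, z₂, …`; here variables are indexed by `ℕ`).
[Ayoub, revisited note, Théorème 1.7 (a), (b)] [cite: AyoubRelKZRevisited, Théorème 1.7] -/
def ayoubGenerators : Set (LaurentSeries (O k)) :=
  {x | ∃ G ∈ Odagger k, ∃ i : ℕ, x = mapCoeff k (relA k i) G} ∪
    {x | ∃ H ∈ Odagger k, ∃ j : ℕ, x = mapCoeff k (euler k j) H}

/-- NAMED FACT (**Ayoub, relative Kontsevich–Zagier revisited, Théorème 1.7**): for a field `k`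
of characteristic `0` embeddable in `ℂ`, an algebraic Laurent series `F ∈ 𝒪†_alg(𝔸^∞ × 𝔼^∞)`
has term-by-term integral `∫ F = 0 ∈ k((ϖ))` iff `F` lies in the `k`-span of the generators (a),
(b). Users take `(h : ayoub_relativeKZ_revisited)`. (This is the author's CORRECTED, purely
algebraic form; the Annals Thm. 4.25 / note Thm. 1.1 for `𝒪†_{k-alg}(𝔻̄^∞)` is only established
when `π` is algebraic over `k`, note Rem. 1.3, and is deliberately NOT vendored.)
[Ayoub, revisited note, Théorème 1.7; cf. Ann. of Math. 181 (2015) Thm. 4.25 and note Thm. 1.11] [cite: AyoubRelKZRevisited, Théorème 1.7] -/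
def ayoub_relativeKZ_revisited : Prop :=
  ∀ (k : Type) [Field k] [CharZero k], Nonempty (k →+* ℂ) →
    ∀ F ∈ Odagger k, intLaurent k F = 0 ↔ F ∈ Submodule.span k (ayoubGenerators k)

/-! ### API (sanity of the operators) -/

variable {k}

/-- `∫ z^a t^b` is the monomial weight. [Ayoub, revisited note, Lemme 1.5] [folklore] -/
@[simp] theorem intO_mono (m : Mono) : intO k (mono k m) = monoWeight k m := by
  simp [intO, mono, AddMonoidAlgebra.coeff_single, Finsupp.linearCombination_single]

/-- `∫ 1 = 1`. [Ayoub, revisited note, Lemme 1.4] [folklore] -/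
theorem intO_one : intO k (mono k (0, 0)) = 1 := by
  simp [monoWeight]

/-- `∫ zᵢ = 1/2`. [Ayoub, revisited note, Lemme 1.4] [folklore] -/
theorem intO_z (i : ℕ) : intO k (mono k (Finsupp.single i 1, 0)) = 2⁻¹ := by
  rw [intO_mono, monoWeight, if_pos rfl]
  norm_num

/-- `∫ tⱼ = 0` (a non-constant Laurent monomial has zero residue). [Ayoub, revisited note,
Lemme 1.5] [folklore] -/
theorem intO_t (j : ℕ) : intO k (mono k (0, Finsupp.single j 1)) = 0 := by
  rw [intO_mono, monoWeight, if_neg]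
  simp [Finsupp.single_eq_zero]

/-- The Euler operator on a monomial. [folklore] -/
@[simp] theorem euler_mono (j : ℕ) (m : Mono) : euler k j (mono k m) = (m.2 j : k) • mono k m := by
  simp [euler, mono, AddMonoidAlgebra.coeff_single, Finsupp.linearCombination_single]

/-- Type (b) generators are killed by `∫` already on `𝒪`: `∫ tⱼ ∂(z^a t^b)/∂tⱼ · … = bⱼ ∫ z^a t^b = 0`
(either `bⱼ = 0` or `b ≠ 0`). [Ayoub, revisited note, Théorème 1.7 (easy inclusion)] [folklore] -/
theorem intO_euler_mono (j : ℕ) (m : Mono) : intO k (euler k j (mono k m)) = 0 := by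
  rw [euler_mono, map_smul, intO_mono, monoWeight]
  split_ifs with h
  · simp [h]
  · simp

/-- Restriction on a monomial. [folklore] -/
@[simp] theorem restr_mono (i : ℕ) (c : k) (m : Mono) :
    restr k i c (mono k m) = c ^ (m.1 i) • mono k (m.1.erase i, m.2) := by
  simp [restr, mono, AddMonoidAlgebra.coeff_single, Finsupp.linearCombination_single]

/-- `∂/∂zᵢ` on a monomial. [folklore] -/
@[simp] theorem dz_mono (i : ℕ) (m : Mono) :
    dz k i (mono k m) = (m.1 i : k) • mono k (m.1 - Finsupp.single i 1, m.2) := by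
  simp [dz, mono, AddMonoidAlgebra.coeff_single, Finsupp.linearCombination_single]

/-- The type (a) relation for the monomial `zᵢ`: `∂zᵢ/∂zᵢ - zᵢ|₁ + zᵢ|₀ = 1 - 1 + 0 = 0` — and
indeed `∫` of it vanishes. [Ayoub, revisited note, Théorème 1.7 (a)] [folklore] -/
theorem relA_z (i : ℕ) : relA k i (mono k (Finsupp.single i 1, 0)) = 0 := by
  simp [relA, sub_self]

/-! ### The easy inclusion of Théorème 1.7: the generators are killed by `∫`

Théorème 1.7 asserts `ker ∫ = span (a) ∪ (b)` on `𝒪†_alg`. The inclusion `⊇` is elementary calculus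
(`∫₀¹ ∂G/∂zᵢ dzᵢ = G|_{zᵢ=1} - G|_{zᵢ=0}`, `∮ tⱼ ∂H/∂tⱼ dtⱼ/tⱼ = 0`) and is proved below,
unconditionally and coefficientwise, WITHOUT the algebraicity hypothesis. The inclusion `⊆` is the
deep content of the note (its §2: Voevodsky motives over `k(ϖ)`, rigid-analytic motives, the Betti
realisation and the torsor of periods — Théorèmes 2.4 and 2.6 there) and stays a named fact. -/

/-- The `z`-weight `∏ᵢ (aᵢ + 1)⁻¹` may be computed over any finite set of indices containing the
support of `a` (off the support the factor is `(0 + 1)⁻¹ = 1`). [folklore] -/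
theorem monoWeight_zero_eq_prod (a : ℕ →₀ ℕ) (s : Finset ℕ) (hs : a.support ⊆ s) :
    monoWeight k (a, 0) = ∏ i ∈ s, ((a i : k) + 1)⁻¹ := by
  rw [monoWeight, if_pos rfl]
  exact Finset.prod_subset hs fun i _ hi => by
    rw [Finsupp.notMem_support_iff.mp hi]; simp

/-- A monomial with a non-trivial `t`-part has integral `0`. [Ayoub, revisited note, Lemme 1.5]
[folklore] -/
theorem monoWeight_of_ne_zero (a : ℕ →₀ ℕ) {b : ℕ →₀ ℤ} (hb : b ≠ 0) :
    monoWeight k (a, b) = 0 := by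
  rw [monoWeight, if_neg hb]

/-- **Fundamental theorem of calculus in `zᵢ`, on monomials**: for `m = z^a t^b`,
`∫ (∂m/∂zᵢ - m|_{zᵢ=1} + m|_{zᵢ=0}) = 0`. (If `aᵢ = 0` the derivative vanishes and the two
restrictions agree; if `aᵢ = p + 1` the restriction at `0` vanishes and
`(p+1) · (p+1)⁻¹ ∏_{j≠i} = 1 · ∏_{j≠i}`.) [Ayoub, revisited note, Théorème 1.7 (a), easy inclusion]
[folklore] -/
theorem intO_relA_mono [CharZero k] (i : ℕ) (m : Mono) : intO k (relA k i (mono k m)) = 0 := by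
  obtain ⟨a, b⟩ := m
  simp only [relA, LinearMap.add_apply, LinearMap.sub_apply, dz_mono, restr_mono, map_add, map_sub,
    map_smul, intO_mono, one_pow, one_smul, smul_eq_mul]
  by_cases hb : b = 0
  · subst hb
    rcases Nat.eq_zero_or_pos (a i) with h0 | hpos
    · -- `aᵢ = 0`: no derivative term, and the two restrictions cancel (`0 ^ 0 = 1`).
      simp [h0]
    · obtain ⟨p, hp⟩ : ∃ p, a i = p + 1 := ⟨a i - 1, by omega⟩
      have hi : i ∈ a.support := Finsupp.mem_support_iff.mpr (by omega)
      have hs1 : (a - Finsupp.single i 1).support ⊆ a.support := Finsupp.support_tsub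
      have hs2 : (a.erase i).support ⊆ a.support := by
        classical
        rw [Finsupp.support_erase]; exact Finset.erase_subset _ _
      classical
      rw [monoWeight_zero_eq_prod (k := k) _ _ hs1, monoWeight_zero_eq_prod (k := k) _ _ hs2,
        ← Finset.mul_prod_erase _ _ hi, ← Finset.mul_prod_erase _ _ hi]
      have hrest : ∏ j ∈ a.support.erase i, ((((a - Finsupp.single i 1 : ℕ →₀ ℕ) j : ℕ) : k) + 1)⁻¹ =
          ∏ j ∈ a.support.erase i, ((((a.erase i) j : ℕ) : k) + 1)⁻¹ :=
        Finset.prod_congr rfl fun j hj => by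
          have hji : j ≠ i := Finset.ne_of_mem_erase hj
          rw [Finsupp.tsub_apply, Finsupp.single_apply, if_neg hji.symm, Nat.sub_zero,
            Finsupp.erase_ne hji]
      have e1 : (a - Finsupp.single i 1 : ℕ →₀ ℕ) i = p := by
        rw [Finsupp.tsub_apply, Finsupp.single_apply, if_pos rfl, hp]; omega
      have hp1 : ((p : k) + 1) ≠ 0 := by exact_mod_cast Nat.succ_ne_zero p
      rw [hrest, e1, Finsupp.erase_same, hp, zero_pow (Nat.succ_ne_zero p), zero_mul, add_zero]
      push_cast
      rw [zero_add, inv_one, one_mul, ← mul_assoc, mul_inv_cancel₀ hp1, one_mul, sub_self]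
  · simp [monoWeight_of_ne_zero (k := k) _ hb]

/-- `∫ ∘ (∂/∂zᵢ - |_{zᵢ=1} + |_{zᵢ=0}) = 0` on `𝒪`. [Ayoub, revisited note, Théorème 1.7 (a), easy
inclusion] [folklore] -/
theorem intO_comp_relA [CharZero k] (i : ℕ) : intO k ∘ₗ relA k i = 0 := by
  have key : ∀ x : O k, intO k (relA k i x) = 0 := fun x => by
    induction x using AddMonoidAlgebra.induction_linear with
    | zero => simp
    | add x y hx hy => rw [map_add, map_add, hx, hy, add_zero]
    | single m r =>
      have : (AddMonoidAlgebra.single m r : O k) = r • mono k m := by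
        rw [mono, AddMonoidAlgebra.smul_single, smul_eq_mul, mul_one]
      rw [this, map_smul, map_smul, intO_relA_mono, smul_zero]
  ext x
  exact key _

/-- `∫ ∘ (tⱼ ∂/∂tⱼ) = 0` on `𝒪`. [Ayoub, revisited note, Théorème 1.7 (b), easy inclusion]
[folklore] -/
theorem intO_comp_euler (j : ℕ) : intO k ∘ₗ euler k j = 0 := by
  have key : ∀ x : O k, intO k (euler k j x) = 0 := fun x => by
    induction x using AddMonoidAlgebra.induction_linear with
    | zero => simp
    | add x y hx hy => rw [map_add, map_add, hx, hy, add_zero]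
    | single m r =>
      have : (AddMonoidAlgebra.single m r : O k) = r • mono k m := by
        rw [mono, AddMonoidAlgebra.smul_single, smul_eq_mul, mul_one]
      rw [this, map_smul, map_smul, intO_euler_mono, smul_zero]
  ext x
  exact key _

/-- Coefficientwise application is functorial: `mapCoeff f (mapCoeff g F) = mapCoeff (f ∘ g) F`.
[folklore] -/
theorem mapCoeff_mapCoeff {U V W : Type} [AddCommGroup U] [Module k U] [AddCommGroup V] [Module k V]
    [AddCommGroup W] [Module k W] (f : V →ₗ[k] W) (g : U →ₗ[k] V) (F : LaurentSeries U) :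
    mapCoeff k f (mapCoeff k g F) = mapCoeff k (f ∘ₗ g) F := by
  ext n; rfl

/-- The zero map applied coefficientwise is zero. [folklore] -/
theorem mapCoeff_zero {V W : Type} [AddCommGroup V] [Module k V] [AddCommGroup W] [Module k W]
    (F : LaurentSeries V) : mapCoeff k (0 : V →ₗ[k] W) F = 0 := by
  ext n; rfl

/-- Term-by-term integration kills every type (a) generator `∂G/∂zᵢ - G|_{zᵢ=1} + G|_{zᵢ=0}`,
for ANY Laurent series `G ∈ 𝒪((ϖ))` (algebraic or not).
[Ayoub, revisited note, Théorème 1.7 (a), easy inclusion] [cite: AyoubRelKZRevisited, Théorème 1.7] -/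
theorem intLaurent_mapCoeff_relA [CharZero k] (i : ℕ) (G : LaurentSeries (O k)) :
    intLaurent k (mapCoeff k (relA k i) G) = 0 := by
  rw [intLaurent, mapCoeff_mapCoeff, intO_comp_relA, mapCoeff_zero]

/-- Term-by-term integration kills every type (b) generator `tⱼ ∂H/∂tⱼ`, for ANY Laurent series
`H ∈ 𝒪((ϖ))`. [Ayoub, revisited note, Théorème 1.7 (b), easy inclusion]
[cite: AyoubRelKZRevisited, Théorème 1.7] -/
theorem intLaurent_mapCoeff_euler (j : ℕ) (H : LaurentSeries (O k)) :
    intLaurent k (mapCoeff k (euler k j) H) = 0 := by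
  rw [intLaurent, mapCoeff_mapCoeff, intO_comp_euler, mapCoeff_zero]

/-- **Théorème 1.7, the inclusion `span (a) ∪ (b) ⊆ ker ∫`** (proved): the `k`-span of Ayoub's
generators lies in the kernel of term-by-term integration. [Ayoub, revisited note, Théorème 1.7
(easy inclusion)] [cite: AyoubRelKZRevisited, Théorème 1.7] -/
theorem span_ayoubGenerators_le_ker (k : Type) [Field k] [CharZero k] :
    Submodule.span k (ayoubGenerators k) ≤ LinearMap.ker (intLaurent k) := by
  rw [Submodule.span_le]
  rintro x (⟨G, -, i, rfl⟩ | ⟨H, -, j, rfl⟩)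
  · exact LinearMap.mem_ker.mpr (intLaurent_mapCoeff_relA i G)
  · exact LinearMap.mem_ker.mpr (intLaurent_mapCoeff_euler j H)

/-- **Théorème 1.7, direction `⇐`** (proved, for every field of characteristic `0`, no embedding
into `ℂ` and no algebraicity needed): an element of the span of the generators has zero integral.
This is the `←` half of the `iff` in `ayoub_relativeKZ_revisited`; the `→` half is the deep,
motivic content of the note and remains the named fact.
[Ayoub, revisited note, Théorème 1.7 (easy inclusion)] [cite: AyoubRelKZRevisited, Théorème 1.7] -/
theorem ayoub_relativeKZ_revisited_easy (k : Type) [Field k] [CharZero k]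
    (F : LaurentSeries (O k)) (hF : F ∈ Submodule.span k (ayoubGenerators k)) :
    intLaurent k F = 0 :=
  LinearMap.mem_ker.mp (span_ayoubGenerators_le_ker k hF)

end Literature.NumberTheory.Transcendental.AyoubRel
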